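import Summits.BirchSwinnertonDyer.BirchSwinnertonDyer.Theorems.AdditiveBranchIMCGordTwoRankZeroOffCaseOneFieldSupplyR0
import HarnessLib

/-!
# DRAFT (pen bsd-addord-plan g48, e23; for the LEAD lineage / typers — NOT a Theorems file, NOT a Literature fact) —
# «door F» row vocabulary: the Fouquet–Wan hypotheses (irr) / (Langlands) / (Steinberg) on the (G-ord, `e = 2`) rank-0 cell

Director-bsd (776)(A) 2026-08-31T08:05Z: the PREPRINT Fouquet–Wan, «The Iwasawa Main Conjecture for modular motives», arXiv:2107.13726
(2021; no journal record as of 2026-08-31; Fouquet 2024, Publ. Math. Besançon doi:10.5802/pmb.54, states that no published result covers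
additive reduction) Thm 1.1 / Cor 1.10 is ADMISSIBLE as a typed Literature READING under rails (i)–(v) (status verbatim in the docstring, debt
flagged `preprint`, rows booked in a SEPARATE column «r₀ modulo PREPRINT (door F)», typer order AFTER R2₂/R3₂/R4₂, LEAD glue after the door-D
frame). This file drafts ONLY the two row predicates the reading and the glue will quantify over, plus the conservative variant and the
one-line comparisons with the line vocabulary of record (`ThreeFieldRoadSupply.WanPrime`). Dictionary and census: HOME
`planner/g2_3f_enlarge/e23/README.md` (06cef8db8f3b314a) §3–§4.

PRINT (arXiv:2107.13726 v3 p. 2, Thm 1.1): `p > 2`; `f ∈ S_k(Γ₀(N))` normalised eigencuspform, `k ≥ 2`; (irr) `ρ̄_f` absolutely irreducible;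
(Langlands) `(ρ̄_f|G_{ℚ_p})^ss ≠ χ ⊕ χ` and `≠ χ ⊕ χ·χ̄_cyc`; (Steinberg) `∃ ℓ ∤ p`, `ℓ ∥ N`, `dim ρ̄^{I_ℓ} = 1`, `dim ρ̄^{G_ℓ} = 0`. Cor 1.10 (p. 6):
for `A/ℚ` of GL₂-type with newform `f`, `L(A,1) ≠ 0`, `A[p]` as in Thm 1.1: `v_p(L(A,1)/Ω_f) = v_p(#Ш(A/ℚ)[p^∞]·∏_{q∣N} Tam_q(A/ℚ))`.

ON THE CELL (`E/ℚ` globally minimal `W`, `p ≥ 5`, `E` additive at `p`, potentially good with `e_p = 2`, so `W = C • V^{(p*)}` for a globally minimal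
`V` good ORDINARY at `p` — `TypeGOrd.exists_goodOrd_pStar_twist_model`): `(ρ̄_E|G_{ℚ_p})^ss = ω^{(p−1)/2}·(unr(α⁻¹)·χ̄_cyc ⊕ unr(α))` with
`α ≡ a_p(V) (mod p)` the unit root, so (Langlands) ⟺ `α² ≢ 1` ⟺ `a_p(V)² ≢ 1 (mod p)` (`LanglandsGenericAt`); at `ℓ ∥ N`, `ρ̄|G_ℓ` is the Tate
extension twisted by the unramified `δ_ℓ = ±1`, `dim ρ̄^{I_ℓ} = 1 ⟺ p ∤ v_ℓ(Δ_min)`, and then `ρ̄^{G_ℓ} = 0 ⟺ δ_ℓ·ℓ ≢ 1 (mod p)`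
(`SteinbergPrimeAt`, LITERAL reading; the authors' gloss «Steinberg twisted by the unramified character `ℓ ↦ (−1)ℓ^{k/2−1}`» = `a_ℓ = −1` =
NON-split gives the conservative `SteinbergPrimeNonsplitAt` = the line's `WanPrime` ∧ `p ∤ ℓ + 1`). (irr): an odd irreducible `ρ̄ : G_ℚ → GL₂(𝔽_p)`,
`p` odd, is absolutely irreducible (complex conjugation has distinct eigenvalues) — `Irr W p` suffices [folklore].

DEFINITIONS + three one-line comparison lemmas ONLY; nothing asserted about any curve; no instance, no notation, no `sorry`. BSD is proved for
no curve by this file.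

References: [FouquetWan2021] O. Fouquet, X. Wan, arXiv:2107.13726, Thm. 1.1 (p. 2), Cor. 1.10 (p. 6) — PREPRINT; [Fouquet2024PMB] O. Fouquet,
Publ. Math. Besançon 2024, doi:10.5802/pmb.54, Thm. 1.1 (p. 24); [SkinnerUrban2014] Thm. 3.6.4 (the ramification clause `p ∤ v_ℓ(Δ)`).
-/

set_option linter.dupNamespace false
set_option autoImplicit false

noncomputable section

open scoped Classical

open WeierstrassCurve Literature.NumberTheory.EllipticCurves
  Literature.NumberTheory.EllipticCurves.Rank1Residual
  Literature.NumberTheory.EllipticCurves.Rank1Residual.Typed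

open Summit.BirchSwinnertonDyer.Rank1Residual
open Summit.BirchSwinnertonDyer.Rank1Residual.Additive
open Summit.BirchSwinnertonDyer.BirchSwinnertonDyer.Theorems
open ThreeFieldRoadSupply

namespace Summit.BirchSwinnertonDyer.BirchSwinnertonDyer.Theorems.FouquetWanRoad

/-- **(Langlands) on the (G-ord, `e = 2`) cell** — Fouquet–Wan Thm 1.1's second hypothesis read on `E = C • V^{(p*)}`: for EVERY globally
minimal good-ordinary twist model `V` of `W` at `p* = (−1)^{(p−1)/2} p`, `a_p(V)² ≢ 1 (mod p)` (the unit root `α ≡ a_p(V)` satisfies `α² ≢ 1`,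
i.e. the two characters of `(ρ̄_E|G_{ℚ_p})^ss` do not differ by `χ̄_cyc^{±1}`). Independent of the choice of `(V, C)` (isomorphic minimal
models have the same `a_p`); decidable from the curve. [predicate; nothing asserted]
(PREPRINT) [cite: FouquetWan2021, Thm. 1.1 (arXiv:2107.13726 p. 2)] -/
def LanglandsGenericAt (W : WeierstrassCurve ℚ) (p : ℕ) [Fact p.Prime] : Prop :=
  ∀ (V : WeierstrassCurve ℚ) [V.IsElliptic] [V.IsGloballyMinimal] (C : VariableChange ℚ),
    C • V.quadraticTwist ((-1 : ℚ) ^ (p / 2) * p) = W → GoodOrd V p →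
      ¬ (p : ℤ) ∣ V.frobeniusTrace p ^ 2 - 1

/-- **(Steinberg) prime, LITERAL reading** — Fouquet–Wan Thm 1.1's third hypothesis on `E` (globally minimal `W`): a prime `ℓ ≠ p` with
`ℓ ∥ N` (multiplicative reduction), `dim ρ̄^{I_ℓ} = 1` (`ρ̄_{E,p}` ramified at `ℓ`: `p ∤ v_ℓ(Δ_min)`, Skinner–Urban's clause) and `ρ̄^{G_ℓ} = 0`
(Frobenius acts non-trivially on the inertia-invariant line: `ℓ ≢ 1 (mod p)` if split, `ℓ ≢ −1 (mod p)` if non-split). ANY split type,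
`ℓ = 2` allowed. [predicate; nothing asserted] (PREPRINT) [cite: FouquetWan2021, Thm. 1.1 (arXiv:2107.13726 p. 2)]
[cite: SkinnerUrban2014, Thm. 3.6.4] -/
def SteinbergPrimeAt (W : WeierstrassCurve ℚ) [W.IsGloballyMinimal] (p ℓ : ℕ) [Fact ℓ.Prime] : Prop :=
  ℓ ≠ p ∧ W.HasMultiplicativeReductionAtPrime ℓ ∧ ¬ p ∣ padicValInt ℓ W.minimalDiscriminantInt ∧
    (W.HasSplitMultiplicativeReductionAtPrime ℓ → ¬ p ∣ ℓ - 1) ∧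
    (¬ W.HasSplitMultiplicativeReductionAtPrime ℓ → ¬ p ∣ ℓ + 1)

/-- **(Steinberg) prime, CONSERVATIVE reading** (the authors' gloss «`π(f)_ℓ` special Steinberg twisted by the unramified character
`ℓ ↦ (−1)ℓ^{k/2−1}`», i.e. `a_ℓ = −1`, NON-split multiplicative — the convention of the cell's typed CLW/Wan facts — together with the literal
`G_ℓ`-invariant clause): the line's Wan prime of record (`q ≠ p, 2`, non-split, `p ∤ v_q(Δ_min)`) with `p ∤ q + 1`.
[predicate; nothing asserted] (PREPRINT) [cite: FouquetWan2021, Thm. 1.1 (arXiv:2107.13726 p. 2)] -/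
def SteinbergPrimeNonsplitAt (W : WeierstrassCurve ℚ) [W.IsGloballyMinimal] (p ℓ : ℕ) [Fact ℓ.Prime] : Prop :=
  WanPrime W p ℓ ∧ ¬ p ∣ ℓ + 1

/-- **THE DOOR-F SUB-ROW of the rank-zero line (crux 19357 `GordTwoRankZeroOffCaseOne`), literal reading**: `p ≥ 5`, `ρ̄_{E,p}` irreducible,
(Langlands), a literal (Steinberg) prime. NO clause on the other additive primes of `E`, NO Tamagawa clause, split Steinberg primes allowed.
Census (e23, Cremona `N < 5·10^5`, r0 universe 39 800): 27 167 rows = 68.3 %, of which 15 027 beyond the members of record.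
[predicate; nothing asserted] (PREPRINT) [cite: FouquetWan2021, Cor. 1.10 (arXiv:2107.13726 p. 6)] -/
def FouquetWanRowR0 (W : WeierstrassCurve ℚ) [W.IsGloballyMinimal] (p : ℕ) [Fact p.Prime] : Prop :=
  5 ≤ p ∧ Irr W p ∧ LanglandsGenericAt W p ∧ ∃ ℓ : ℕ, ∃ _ : Fact ℓ.Prime, SteinbergPrimeAt W p ℓ

/-- **THE DOOR-F SUB-ROW, conservative reading** (non-split odd Steinberg prime with `p ∤ ℓ + 1`). Census (e23): 17 186 rows = 43.2 %, of which
7 370 beyond the members of record. [predicate; nothing asserted] (PREPRINT) [cite: FouquetWan2021, Cor. 1.10 (arXiv:2107.13726 p. 6)] -/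
def FouquetWanRowR0Nonsplit (W : WeierstrassCurve ℚ) [W.IsGloballyMinimal] (p : ℕ) [Fact p.Prime] : Prop :=
  5 ≤ p ∧ Irr W p ∧ LanglandsGenericAt W p ∧ ∃ ℓ : ℕ, ∃ _ : Fact ℓ.Prime, SteinbergPrimeNonsplitAt W p ℓ

variable {W : WeierstrassCurve ℚ} [W.IsGloballyMinimal] {p : ℕ} [Fact p.Prime]

omit [Fact p.Prime] in
/-- The conservative Steinberg prime is a literal one (the split branch is vacuous). Bookkeeping. [folklore] -/
theorem steinbergPrimeAt_of_nonsplit {ℓ : ℕ} [Fact ℓ.Prime] (h : SteinbergPrimeNonsplitAt W p ℓ) :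
    SteinbergPrimeAt W p ℓ := by
  obtain ⟨⟨hℓp, _, hmult, hns, hram⟩, hℓ1⟩ := h
  exact ⟨hℓp, hmult, hram, fun hs ↦ absurd hs hns, fun _ ↦ hℓ1⟩

/-- The conservative door-F sub-row lies inside the literal one. Bookkeeping. [folklore] -/
theorem fouquetWanRowR0_of_nonsplit (h : FouquetWanRowR0Nonsplit W p) : FouquetWanRowR0 W p := by
  obtain ⟨hp5, hirr, hlan, ℓ, hℓ, hst⟩ := h
  exact ⟨hp5, hirr, hlan, ℓ, hℓ, steinbergPrimeAt_of_nonsplit hst⟩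

omit [Fact p.Prime] in
/-- A conservative Steinberg prime is in particular a Wan prime of the line of record (so the three-field FIELD supply at `q := ℓ` is
available to the glue if wanted). Bookkeeping. [folklore] -/
theorem wanPrime_of_steinbergPrimeNonsplitAt {ℓ : ℕ} [Fact ℓ.Prime] (h : SteinbergPrimeNonsplitAt W p ℓ) :
    WanPrime W p ℓ := h.1

end Summit.BirchSwinnertonDyer.BirchSwinnertonDyer.Theorems.FouquetWanRoad

end
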